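import Mathlib

/-!
# Configuration clustering and the value count (B-plan lemmas B4, B10a)

Crux workfile for `stmt-ValiantsHypothesis-19979` (`Theses.LacunarySymmetroid.DoorA26`), line
`Cruxes/DoorA26/Lines/wall_bubbling`, obligation (B) `Stmt.stub_bubbling`, plan `Lines/wall_bubbling_B-plan.md`.
Mathlib-only, self-contained; companion of `Lines/wall_bubbling_TwistedRolleExp.lean` (B1–B3) and
`Lines/wall_bubbling_Clusters.lean` (B8–B9).

* `exists_subseq_tendsto_atTop_of_not_bddAbove` — an unbounded real sequence has a subsequence tending to `+∞`;
* `gaps_dichotomy` (B4) — for finitely many nonnegative gap sequences there is ONE common subsequence along which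
  every gap is either uniformly bounded or tends to `+∞` (blocks = maximal runs of bounded gaps);
* `telescoping_bound` — bounded consecutive gaps on a run bound the diameter of the run;
* `card_pairSums_le_twenty` (B10a) — a coincidence `δ i + δ j = δ k + δ l` between two different unordered pairs
  forces at most `20` distinct pair sums.

Nothing here proves `DoorA26`; VP ≠ VNP is not moved.  [folklore]
-/

namespace Summit.ValiantsHypothesis.ValiantsHypothesis.Cruxes.DoorA26.WallBubbling.Config

open Finset Filter Topology

/-! ## Subsequences -/

/-- An unbounded-above real sequence has a subsequence tending to `+∞`. [folklore] -/
theorem exists_subseq_tendsto_atTop_of_not_bddAbove (u : ℕ → ℝ) (h : ¬ BddAbove (Set.range u)) :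
    ∃ ψ : ℕ → ℕ, StrictMono ψ ∧ Tendsto (u ∘ ψ) atTop atTop := by
  have hfreq : ∀ M : ℝ, ∃ᶠ k in atTop, M < u k := by
    intro M
    rw [Filter.frequently_atTop]
    intro a
    by_contra hcon
    push Not at hcon
    apply h
    refine ⟨max M (∑ k ∈ Finset.range a, |u k|), ?_⟩
    rintro y ⟨k, rfl⟩
    rcases Nat.lt_or_ge k a with hk | hk
    · have : |u k| ≤ ∑ k ∈ Finset.range a, |u k| :=
        Finset.single_le_sum (f := fun k => |u k|) (fun _ _ => abs_nonneg _) (Finset.mem_range.mpr hk)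
      exact le_trans (le_trans (le_abs_self _) this) (le_max_right _ _)
    · exact le_trans (hcon k hk) (le_max_left _ _)
  obtain ⟨ψ, hψ, hψP⟩ := Filter.extraction_forall_of_frequently (fun n : ℕ => hfreq (n : ℝ))
  refine ⟨ψ, hψ, ?_⟩
  exact tendsto_atTop_mono (fun n => (hψP n).le) tendsto_natCast_atTop_atTop

/-! ## B4 — the gap dichotomy along one common subsequence -/

/-- **B4.**  Finitely many real sequences admit ONE common subsequence along which each of them is either uniformly
bounded above or tends to `+∞`. [folklore: Bolzano–Weierstrass bookkeeping] -/
theorem gaps_dichotomy (K : ℕ) : ∀ (g : ℕ → Fin K → ℝ),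
    ∃ φ : ℕ → ℕ, StrictMono φ ∧ ∃ B : ℝ, ∀ k,
      (∀ n, g (φ n) k ≤ B) ∨ Tendsto (fun n => g (φ n) k) atTop atTop := by
  induction K with
  | zero =>
    intro g
    exact ⟨id, strictMono_id, 0, fun k => k.elim0⟩
  | succ K ih =>
    intro g
    obtain ⟨φ₁, hφ₁, B₁, h₁⟩ := ih (fun ν k => g ν k.castSucc)
    set u : ℕ → ℝ := fun n => g (φ₁ n) (Fin.last K) with hu
    by_cases hb : BddAbove (Set.range u)
    · obtain ⟨M, hM⟩ := hb
      refine ⟨φ₁, hφ₁, max B₁ M, fun k => ?_⟩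
      rcases Fin.eq_castSucc_or_eq_last k with ⟨k', rfl⟩ | rfl
      · rcases h₁ k' with hbk | htk
        · exact Or.inl fun n => le_trans (hbk n) (le_max_left _ _)
        · exact Or.inr htk
      · exact Or.inl fun n => le_trans (hM ⟨n, rfl⟩) (le_max_right _ _)
    · obtain ⟨ψ, hψ, hlim⟩ := exists_subseq_tendsto_atTop_of_not_bddAbove u hb
      refine ⟨φ₁ ∘ ψ, hφ₁.comp hψ, B₁, fun k => ?_⟩
      rcases Fin.eq_castSucc_or_eq_last k with ⟨k', rfl⟩ | rfl
      · rcases h₁ k' with hbk | htk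
        · exact Or.inl fun n => hbk (ψ n)
        · exact Or.inr (htk.comp hψ.tendsto_atTop)
      · exact Or.inr hlim

/-- The gap dichotomy for the consecutive gaps of strictly increasing configurations (the form used for zero
clusters: `z ν` = the sorted zeros of the `ν`-th approximant). [folklore] -/
theorem cluster_dichotomy {N : ℕ} (z : ℕ → Fin (N + 1) → ℝ) :
    ∃ φ : ℕ → ℕ, StrictMono φ ∧ ∃ B : ℝ, ∀ k : Fin N,
      (∀ n, z (φ n) k.succ - z (φ n) k.castSucc ≤ B) ∨
        Tendsto (fun n => z (φ n) k.succ - z (φ n) k.castSucc) atTop atTop :=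
  gaps_dichotomy N (fun ν k => z ν k.succ - z ν k.castSucc)

/-- Bounded consecutive gaps on a run `i ≤ k < j` bound the diameter of the run. [folklore] -/
theorem telescoping_bound (u : ℕ → ℝ) (B : ℝ) (i : ℕ) :
    ∀ j, i ≤ j → (∀ k, i ≤ k → k < j → u (k + 1) - u k ≤ B) → u j - u i ≤ (j - i : ℕ) * B := by
  intro j hij
  induction j, hij using Nat.le_induction with
  | base =>
    intro _
    simp
  | succ j hij ih =>
    intro hgap
    have h1 : u j - u i ≤ (j - i : ℕ) * B := ih fun k hk hkj => hgap k hk (Nat.lt_succ_of_lt hkj)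
    have h2 : u (j + 1) - u j ≤ B := hgap j hij (Nat.lt_succ_self j)
    have h3 : ((j + 1 - i : ℕ) : ℝ) = ((j - i : ℕ) : ℝ) + 1 := by
      rw [Nat.succ_sub hij]
      push_cast
      ring
    rw [h3]
    linarith

/-! ## B10a — a coincidence costs a value -/

/-- The `21` unordered index pairs. -/
theorem card_unorderedPairs :
    (Finset.univ.filter fun p : Fin 6 × Fin 6 => p.1 ≤ p.2).card = 21 := by decide

/-- Sorting a pair does not change `{i, j}`: distinct as ordered pairs in both orders ⇒ distinct sorted pairs. -/
theorem sortedPair_ne : ∀ i j k l : Fin 6, (i, j) ≠ (k, l) → (i, j) ≠ (l, k) →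
    (min i j, max i j) ≠ (min k l, max k l) := by decide

/-- **B10a.**  If two different unordered pairs have the same sum then the pair sums take at most `20` values.
[folklore] -/
theorem card_pairSums_le_twenty (δ : Fin 6 → ℝ)
    (h : ∃ i j k l : Fin 6, (i, j) ≠ (k, l) ∧ (i, j) ≠ (l, k) ∧ δ i + δ j = δ k + δ l) :
    (Finset.univ.image fun p : Fin 6 × Fin 6 => δ p.1 + δ p.2).card ≤ 20 := by
  classical
  obtain ⟨i, j, k, l, h1, h2, hsum⟩ := h
  set T : Finset (Fin 6 × Fin 6) := Finset.univ.filter fun p : Fin 6 × Fin 6 => p.1 ≤ p.2 with hT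
  set f : Fin 6 × Fin 6 → ℝ := fun p => δ p.1 + δ p.2 with hf
  set p₀ : Fin 6 × Fin 6 := (min i j, max i j) with hp₀
  set q₀ : Fin 6 × Fin 6 := (min k l, max k l) with hq₀
  have hpq : p₀ ≠ q₀ := sortedPair_ne i j k l h1 h2
  have hfmin : ∀ a b : Fin 6, f (min a b, max a b) = δ a + δ b := by
    intro a b
    simp only [hf]
    rcases le_total a b with hab | hab
    · rw [min_eq_left hab, max_eq_right hab]
    · rw [min_eq_right hab, max_eq_left hab, add_comm]
  have hfp : f p₀ = f q₀ := by rw [hp₀, hq₀, hfmin, hfmin, hsum]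
  have hq₀T : q₀ ∈ T := by
    rw [hT, Finset.mem_filter]
    exact ⟨Finset.mem_univ _, min_le_max⟩
  -- the image over all ordered pairs is the image over `T.erase p₀`
  have hsub : Finset.univ.image f ⊆ (T.erase p₀).image f := by
    intro y hy
    obtain ⟨⟨a, b⟩, _, rfl⟩ := Finset.mem_image.mp hy
    rw [Finset.mem_image]
    by_cases hab : (min a b, max a b) = p₀
    · refine ⟨q₀, Finset.mem_erase.mpr ⟨hpq.symm, hq₀T⟩, ?_⟩
      rw [← hfp, ← hab, hfmin]
    · refine ⟨(min a b, max a b), Finset.mem_erase.mpr ⟨hab, ?_⟩, hfmin a b⟩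
      rw [hT, Finset.mem_filter]
      exact ⟨Finset.mem_univ _, min_le_max⟩
  have hp₀T : p₀ ∈ T := by
    rw [hT, Finset.mem_filter]
    exact ⟨Finset.mem_univ _, min_le_max⟩
  calc (Finset.univ.image f).card ≤ ((T.erase p₀).image f).card := Finset.card_le_card hsub
    _ ≤ (T.erase p₀).card := Finset.card_image_le
    _ = T.card - 1 := Finset.card_erase_of_mem hp₀T
    _ = 20 := by rw [hT, card_unorderedPairs]

end Summit.ValiantsHypothesis.ValiantsHypothesis.Cruxes.DoorA26.WallBubbling.Config
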